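import Summits.Langlands.Langlands.Theorems.IrreducibilityBySelfDualityPairLBoundaryJSGapProjectedGlobal
import Summits.Langlands.Langlands.Theorems.IrreducibilityBySelfDualityPairLBoundaryJSGapProjectedAnalytic
import Summits.Langlands.Langlands.Theorems.IrreducibilityBySelfDualityPairLBoundaryJSGapProjectedQuotientUnfolding
import Summits.Langlands.Langlands.Theorems.IrreducibilityBySelfDualityPairLBoundaryJSGapProjectedWhittakerUnfolding
import Summits.Langlands.Langlands.Theorems.IrreducibilityBySelfDualityPairLBoundaryJSGapAbsConvergence
import Literature.NumberTheory.Automorphic.JPSSUnfoldedPairIntegralEntire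
import Literature.NumberTheory.Automorphic.AdelicGroupDataAutomorphicMeasureProofs
import Literature.NumberTheory.Automorphic.ClozelAlgebraicityComplexConjProofs

/-!
# The analytic named fact `Cogdell2004_unfoldedPairIntegral_entire n m K` REDUCED to two decay estimates for the
# projected cusp form along the corner (the projector road of line `Sketch`, lead c6)

Summit `Langlands`, sub-problem `Langlands`, helper file under `Theorems/` supporting the crux `PairLBoundaryJS`
(stmt-Langlands-13622), line `Sketch`, registered sub-stub `stub_gap_entire_fact_of_decay`: for `0 < m < n`, the
Literature named fact `Cogdell2004_unfoldedPairIntegral_entire n m K` (Cogdell (2004), Thm. 2.1, analytic clause in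
unfolded form: the unfolded torus integral of two honest cusp forms admits an entire continuation) FOLLOWS from the two
decay estimates of the projector road for honest cusp forms on the automorphic quotients:

* (D1) for every honest `φ` on `X_n`, every compact `Ω ⊆ GL_m(𝔸_K)` and every `B > 0`:
  `‖Φ_m(ι(z(e^u) g))‖ ≤ C e^{-B|u|}` for `g ∈ Ω`, `u ∈ ℝ` (`Φ_m = whittakerDepth m (invQuot φ)`, `ι = glCorner (m ≤ n)`);
* (D2) for every honest pair `(φ, φ')` and every `B > 0`:
  `‖Φ_m(ι h)‖ · ‖(invQuot φ')(h)‖ ≤ C · min(|det h|^B, |det h|^{-B})` for all `h ∈ GL_m(𝔸_K)`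

— the shapes of `exists_bound_corner_scalarExp` / `exists_bound_corner_mul` of `CuspFormCornerDecay` (which prove them
for the bare corner `n = m + 1` by a rational Weyl conjugation), i.e. exactly what a quantitative reduction theory
(successive minima over `K`) has to supply for `m ≤ n - 2`. Road (Cogdell (2004), §2.2.1–2.2 formalised): the
projected integral `I^ℙ = jpssProjIntegral` (`JPSSProjectedGlobalIntegral`) is entire granted (D1), (D2)
(`GapProjectedAnalytic`), unfolds to the torus (`GapProjectedGlobal` with `GapProjectedQuotientUnfolding` and
`GapProjectedWhittakerUnfolding`) on the right half-plane of one-factor absolute convergence (`GapAbsConvergence`), and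
`J(s) = C⁻¹ I^ℙ(s + (n-m)/2; φ, φ̄')` is the entire continuation (as `GapEntireFactSucc` for `n = m + 1`).

## References

* J. W. Cogdell, *Analytic theory of L-functions for GL_n* (2004), §2.2 (PDF pp. 181–184), Thm. 2.1
  [CogdellAnalyticTheory2004].
-/

noncomputable section

-- `Summit.Langlands.Langlands.…` (summit = sub-problem name, D-0017 layout) trips `dupNamespace`
set_option linter.dupNamespace false

open scoped MatrixGroups Topology Pointwise ENNReal NNReal ComplexConjugate InnerProductSpace ContDiff
-- the place subtypes indexing `mixedSpace K` are `Fintype` classically (`NormedCommRing (mixedSpace K)`)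
open scoped Classical Matrix.Norms.Operator
open NumberField IsDedekindDomain MeasureTheory Measure Matrix Set Filter WithZero
open NumberField.mixedEmbedding
open Literature.NumberTheory.Automorphic AdelicGroupData
open Literature.NumberTheory.GaloisRepresentations (ideleGroup HeckeCharacter)
open Literature.MeasureTheory.Group
open Literature.RingTheory.SymmetricFunctions.SymmPoly
open ValuativeRel

-- the automorphic quotient carries the tree's Borel σ-algebra, not Mathlib's quotient σ-algebra
attribute [-instance] Quotient.instMeasurableSpace QuotientGroup.measurableSpace

-- the house local instances, exactly as in `RankinSelbergUnfoldingIdentity`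
attribute [local instance] adelicBorel borelSpace_adelic locallyCompactSpace_adelic secondCountableTopology_gl_adelic
  glAdeleBorel borelSpace_glAdele borelSpace_ideleGroup secondCountableTopology_ideleGroup

-- Mathlib idiom: the commutator Lie ring on matrices, to mention `(archGroupGL n K).lie`
attribute [local instance 100] LieRing.ofAssociativeRing

namespace Summit.Langlands.Langlands.Theorems.GapEntireFactOfDecay

section Main

variable {n m : ℕ} {K : Type} [Field K] [NumberField K]
  [MeasurableSpace (AdeleRing (𝓞 K) K)] [BorelSpace (AdeleRing (𝓞 K) K)]

local notation "𝔸" => AdeleRing (𝓞 K) K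

/-- **The analytic fact from the decay estimates, GRANTED the bricks of the projector road** (everything as
hypotheses: `hG` the global projected theorem of `GapProjectedGlobal` at the given measures, `hA` the differentiability
of `I^ℙ` of `GapProjectedAnalytic`, `hAbs` the one-factor absolute convergence of `GapAbsConvergence`, and the two
decay estimates (D1), (D2) for honest forms). For honest `A_G`-invariant cusp forms `Φ̃` on `GL_n(𝔸_K)`, `Φ̃'` on
`GL_m(𝔸_K)`: descend to the quotients (`invQuot_descend`), pick an automorphic measure on `X_m`, and put
`J(s) = C⁻¹ I^ℙ(s + (n-m)/2; φ, φ̄')`. [cite: CogdellAnalyticTheory2004, §2.2 Thm. 2.1] -/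
theorem entire_of_bricks (hm : 0 < m) (hmn : m < n)
    (νA : Measure (Fin m → ideleGroup K)) [IsHaarMeasure νA]
    (νK : Measure ↥(maximalCompactAdelic m K)) [IsHaarMeasure νK]
    (ν₀ : Measure ↥(adelicUnipotent n K)) [IsHaarMeasure ν₀]
    (ν₀' : Measure ↥(adelicUnipotent m K)) [IsHaarMeasure ν₀']
    (μ' : Measure (AdelicGroupData.gl m K).automorphicQuotient) [(AdelicGroupData.gl m K).IsAutomorphicMeasure μ']
    (hG : ∃ C : ℝ, 0 < C ∧
      ∀ {φ : (AdelicGroupData.gl n K).automorphicQuotient → ℂ},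
        IsCuspFormGL n K (isCompact_glFiniteIntegralLevel_holds n K) (invQuot (AdelicGroupData.gl n K) φ) →
      ∀ {φ' : (AdelicGroupData.gl m K).automorphicQuotient → ℂ},
        IsCuspFormGL m K (isCompact_glFiniteIntegralLevel_holds m K) (invQuot (AdelicGroupData.gl m K) φ') →
      (∀ B : ℝ, 0 < B → ∃ C : ℝ, 0 ≤ C ∧ ∀ h : GL (Fin m) 𝔸,
        ‖whittakerDepth m (invQuot (AdelicGroupData.gl n K) φ) (glCorner 𝔸 hmn.le h)‖ *
            ‖invQuot (AdelicGroupData.gl m K) φ' h‖ ≤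
          C * min ((((glAbsDet m K h : ℝ≥0ˣ) : ℝ≥0) : ℝ) ^ B) ((((glAbsDet m K h : ℝ≥0ˣ) : ℝ≥0) : ℝ) ^ (-B))) →
      ∀ (s : ℂ),
        ∫⁻ p, ‖whittakerDepth 0 (invQuot (AdelicGroupData.gl n K) φ) (glCorner 𝔸 hmn.le (torusPoint m K p))‖ₑ *
            ENNReal.ofReal (torusWeight m K s.re p.1) ∂(νA.prod νK) < ⊤ →
        jpssProjIntegral hmn μ' φ φ' (s + ((n : ℂ) - (m : ℂ)) / 2) =
          (C : ℂ) * ∫ p, torusPairIntegrandC m K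
            (fun g => whittakerDepth 0 (invQuot (AdelicGroupData.gl n K) φ) (glCorner 𝔸 hmn.le g))
            (fun g => conj (whittakerDepth 0 (fun x => conj (invQuot (AdelicGroupData.gl m K) φ' x)) g))
            (fun _ => (1 : ℝ)) s p ∂(νA.prod νK))
    (hA : ∀ {φ : (AdelicGroupData.gl n K).automorphicQuotient → ℂ}
      {φ' : (AdelicGroupData.gl m K).automorphicQuotient → ℂ}, Continuous φ → Continuous φ' →
      (∀ Ω : Set (GL (Fin m) 𝔸), IsCompact Ω → ∀ B : ℝ, 0 < B → ∃ C : ℝ, 0 ≤ C ∧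
        ∀ g ∈ Ω, ∀ u : ℝ, ‖whittakerDepth m (invQuot (AdelicGroupData.gl n K) φ)
          (glCorner 𝔸 hmn.le (scalarExp m K u * g))‖ ≤ C * Real.exp (-B * |u|)) →
      (∀ B : ℝ, 0 < B → ∃ C : ℝ, 0 ≤ C ∧ ∀ h : GL (Fin m) 𝔸,
        ‖whittakerDepth m (invQuot (AdelicGroupData.gl n K) φ) (glCorner 𝔸 hmn.le h)‖ *
            ‖invQuot (AdelicGroupData.gl m K) φ' h‖ ≤
          C * min ((((glAbsDet m K h : ℝ≥0ˣ) : ℝ≥0) : ℝ) ^ B) ((((glAbsDet m K h : ℝ≥0ˣ) : ℝ≥0) : ℝ) ^ (-B))) →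
      Differentiable ℂ (jpssProjIntegral hmn μ' φ φ'))
    (hD1 : ∀ {φ : (AdelicGroupData.gl n K).automorphicQuotient → ℂ},
      IsCuspFormGL n K (isCompact_glFiniteIntegralLevel_holds n K) (invQuot (AdelicGroupData.gl n K) φ) →
      ∀ Ω : Set (GL (Fin m) 𝔸), IsCompact Ω → ∀ B : ℝ, 0 < B → ∃ C : ℝ, 0 ≤ C ∧
        ∀ g ∈ Ω, ∀ u : ℝ, ‖whittakerDepth m (invQuot (AdelicGroupData.gl n K) φ)
          (glCorner 𝔸 hmn.le (scalarExp m K u * g))‖ ≤ C * Real.exp (-B * |u|))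
    (hD2 : ∀ {φ : (AdelicGroupData.gl n K).automorphicQuotient → ℂ}
      {φ' : (AdelicGroupData.gl m K).automorphicQuotient → ℂ},
      IsCuspFormGL n K (isCompact_glFiniteIntegralLevel_holds n K) (invQuot (AdelicGroupData.gl n K) φ) →
      IsCuspFormGL m K (isCompact_glFiniteIntegralLevel_holds m K) (invQuot (AdelicGroupData.gl m K) φ') →
      ∀ B : ℝ, 0 < B → ∃ C : ℝ, 0 ≤ C ∧ ∀ h : GL (Fin m) 𝔸,
        ‖whittakerDepth m (invQuot (AdelicGroupData.gl n K) φ) (glCorner 𝔸 hmn.le h)‖ *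
            ‖invQuot (AdelicGroupData.gl m K) φ' h‖ ≤
          C * min ((((glAbsDet m K h : ℝ≥0ˣ) : ℝ≥0) : ℝ) ^ B) ((((glAbsDet m K h : ℝ≥0ˣ) : ℝ≥0) : ℝ) ^ (-B)))
    {Φ : GL (Fin n) 𝔸 → ℂ} {Φ' : GL (Fin m) 𝔸 → ℂ}
    (hcusp : IsCuspFormGL n K (isCompact_glFiniteIntegralLevel_holds n K) Φ)
    (hcusp' : IsCuspFormGL m K (isCompact_glFiniteIntegralLevel_holds m K) Φ')
    (hΦA : ∀ z ∈ (AdelicGroupData.gl n K).center', ∀ g : (AdelicGroupData.gl n K).Adelic, Φ (z * g) = Φ g)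
    (hΦ'A : ∀ z ∈ (AdelicGroupData.gl m K).center', ∀ g : (AdelicGroupData.gl m K).Adelic, Φ' (z * g) = Φ' g) :
    ∃ (x₀ : ℝ) (J : ℂ → ℂ), Differentiable ℂ J ∧ ∀ s : ℂ, x₀ < s.re →
      J s = ∫ p, torusPairIntegrandC m K
        (fun g => whittakerCoeff ν₀ (unipotentTateDomain n K) (adeleAddChar K) Φ (glCorner 𝔸 hmn.le g))
        (fun g => star (whittakerCoeff ν₀' (unipotentTateDomain m K) (adeleAddChar K) Φ' g))
        (fun _ => (1 : ℝ)) s p ∂(νA.prod νK) := by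
  have hn : 0 < n := hm.trans hmn
  -- (a) descend the honest forms to the automorphic quotients
  obtain ⟨φ, rfl⟩ : ∃ φ : (AdelicGroupData.gl n K).automorphicQuotient → ℂ,
      invQuot (AdelicGroupData.gl n K) φ = Φ :=
    ⟨_, (AdelicGroupData.gl n K).invQuot_descend Φ
      ((AdelicGroupData.gl n K).leftInvariant_quotientSubgroup hcusp.1.leftInvariant hΦA)⟩
  obtain ⟨φ', rfl⟩ : ∃ φ' : (AdelicGroupData.gl m K).automorphicQuotient → ℂ,
      invQuot (AdelicGroupData.gl m K) φ' = Φ' :=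
    ⟨_, (AdelicGroupData.gl m K).invQuot_descend Φ'
      ((AdelicGroupData.gl m K).leftInvariant_quotientSubgroup hcusp'.1.leftInvariant hΦ'A)⟩
  -- the classical data and the bridges `Φ_0 = W_Φ`, `conj (Φ̄')_0 = star W_{Φ'}`
  have hΦc : Continuous (invQuot (AdelicGroupData.gl n K) φ) := hcusp.1.continuous_gl
  have hΦ'c : Continuous (invQuot (AdelicGroupData.gl m K) φ') := hcusp'.1.continuous_gl
  have hW₀ : ∀ g, whittakerDepth 0 (invQuot (AdelicGroupData.gl n K) φ) g =
      whittakerCoeff ν₀ (unipotentTateDomain n K) (adeleAddChar K) (invQuot (AdelicGroupData.gl n K) φ) g :=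
    fun g => whittakerDepth_zero_eq_whittakerCoeff hΦc hn ν₀ g
  have hcc : (fun x : GL (Fin m) 𝔸 => conj (invQuot (AdelicGroupData.gl m K) (star φ') x)) =
      invQuot (AdelicGroupData.gl m K) φ' := by
    funext x
    simp only [invQuot_apply, Pi.star_apply, starRingEnd_apply, star_star]
  have hW₁ : ∀ g, whittakerDepth 0 (fun x => conj (invQuot (AdelicGroupData.gl m K) (star φ') x)) g =
      whittakerCoeff ν₀' (unipotentTateDomain m K) (adeleAddChar K) (invQuot (AdelicGroupData.gl m K) φ') g := fun g => by
    rw [hcc]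
    exact whittakerDepth_zero_eq_whittakerCoeff hΦ'c hm ν₀' g
  -- (b) the pair `(φ, φ̄')`: honest, with the decay estimates
  have hφ'star : IsCuspFormGL m K (isCompact_glFiniteIntegralLevel_holds m K)
      (invQuot (AdelicGroupData.gl m K) (star φ')) := hcusp'.star
  have hdec₁ := hD1 hcusp
  have hdec₂ := hD2 hcusp hφ'star
  -- (c) the right half-plane: one-factor absolute convergence beyond `σ₀`
  obtain ⟨σ₀, hσ₀⟩ := GapAbsConvergence.stub_gap_abs_convergence hm hmn νA νK hcusp hΦA
  -- (d) the global projected theorem at `(φ, φ̄')`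
  obtain ⟨C, hC, hGC⟩ := hG
  -- (e) the entire function `J(s) = C⁻¹ I^ℙ(s + (n-m)/2; φ, φ̄')`
  have hφqc : Continuous φ := continuous_of_continuous_invQuot hΦc
  have hφ'qc : Continuous (star φ') := continuous_of_continuous_invQuot hφ'star.1.continuous_gl
  have hd : Differentiable ℂ (jpssProjIntegral hmn μ' φ (star φ')) := hA hφqc hφ'qc hdec₁ hdec₂
  refine ⟨σ₀, fun s => (C : ℂ)⁻¹ * jpssProjIntegral hmn μ' φ (star φ') (s + ((n : ℂ) - (m : ℂ)) / 2), ?_,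
    fun s hs => ?_⟩
  · exact (hd.comp (differentiable_id.add_const _)).const_mul _
  · have hfin := hσ₀ s.re hs.le
    have hglob := hGC hcusp hφ'star hdec₂ s hfin
    have h01 : ∀ p, torusPairIntegrandC m K
        (fun g => whittakerDepth 0 (invQuot (AdelicGroupData.gl n K) φ) (glCorner 𝔸 hmn.le g))
        (fun g => conj (whittakerDepth 0 (fun x => conj (invQuot (AdelicGroupData.gl m K) (star φ') x)) g))
        (fun _ => (1 : ℝ)) s p = torusPairIntegrandC m K
          (fun g => whittakerCoeff ν₀ (unipotentTateDomain n K) (adeleAddChar K) (invQuot (AdelicGroupData.gl n K) φ)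
            (glCorner 𝔸 hmn.le g))
          (fun g => star (whittakerCoeff ν₀' (unipotentTateDomain m K) (adeleAddChar K)
            (invQuot (AdelicGroupData.gl m K) φ') g))
          (fun _ => (1 : ℝ)) s p := fun p => by
      simp only [torusPairIntegrandC, hW₀, hW₁]
      rfl
    beta_reduce
    rw [hglob, ← mul_assoc, inv_mul_cancel₀ (Complex.ofReal_ne_zero.2 hC.ne'), one_mul]
    exact integral_congr_ae (Eventually.of_forall h01)

end Main

section Registered

/-- **Registered sub-stub `stub_gap_entire_fact_of_decay`** (line `Sketch`, wave 3, lead c6): for `0 < m < n` the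
analytic named fact `Cogdell2004_unfoldedPairIntegral_entire n m K` follows from the two decay estimates (D1), (D2) of
the projector road for honest cusp forms — the bricks being the landed `GapProjectedGlobal.exists_const_projected_of`
(with `GapProjectedQuotientUnfolding.stub_gap_proj_quotient_unfolding` and
`GapProjectedWhittakerUnfolding.stub_gap_proj_whittaker_unfolding`), `GapProjectedAnalytic.stub_gap_proj_analytic` and
`GapAbsConvergence.stub_gap_abs_convergence`. [cite: CogdellAnalyticTheory2004, §2.2 Thm. 2.1] -/
theorem stub_gap_entire_fact_of_decay :
    ∀ {n m : ℕ} {K : Type} [Field K] [NumberField K] (_hm : 0 < m) (hmn : m < n),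
      (∀ {φ : (AdelicGroupData.gl n K).automorphicQuotient → ℂ},
        IsCuspFormGL n K (isCompact_glFiniteIntegralLevel_holds n K) (invQuot (AdelicGroupData.gl n K) φ) →
        ∀ Ω : Set (GL (Fin m) (AdeleRing (𝓞 K) K)), IsCompact Ω → ∀ B : ℝ, 0 < B → ∃ C : ℝ, 0 ≤ C ∧
          ∀ g ∈ Ω, ∀ u : ℝ, ‖whittakerDepth m (invQuot (AdelicGroupData.gl n K) φ)
            (glCorner (AdeleRing (𝓞 K) K) hmn.le (scalarExp m K u * g))‖ ≤ C * Real.exp (-B * |u|)) →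
      (∀ {φ : (AdelicGroupData.gl n K).automorphicQuotient → ℂ}
        {φ' : (AdelicGroupData.gl m K).automorphicQuotient → ℂ},
        IsCuspFormGL n K (isCompact_glFiniteIntegralLevel_holds n K) (invQuot (AdelicGroupData.gl n K) φ) →
        IsCuspFormGL m K (isCompact_glFiniteIntegralLevel_holds m K) (invQuot (AdelicGroupData.gl m K) φ') →
        ∀ B : ℝ, 0 < B → ∃ C : ℝ, 0 ≤ C ∧ ∀ h : GL (Fin m) (AdeleRing (𝓞 K) K),
          ‖whittakerDepth m (invQuot (AdelicGroupData.gl n K) φ) (glCorner (AdeleRing (𝓞 K) K) hmn.le h)‖ *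
              ‖invQuot (AdelicGroupData.gl m K) φ' h‖ ≤
            C * min ((((glAbsDet m K h : ℝ≥0ˣ) : ℝ≥0) : ℝ) ^ B) ((((glAbsDet m K h : ℝ≥0ˣ) : ℝ≥0) : ℝ) ^ (-B))) →
      Cogdell2004_unfoldedPairIntegral_entire n m K := by
  intro n m K _ _ hm hmn hD1 hD2 _ _ _ _ νA _ νK _ ν₀ _ ν₀' _ Φ Φ' hcusp hcusp' hΦA hΦ'A
  -- an automorphic measure on `X_m`
  obtain ⟨μ', hμ'⟩ := AdelicGroupData.exists_isAutomorphicMeasure_gl_holds m K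
  -- the quotient-to-group unfolding brick, continuity hypotheses discharged from honesty
  have hQU : ∀ (ν : Measure (GL (Fin m) (AdeleRing (𝓞 K) K))) [ν.IsHaarMeasure], ∃ C : ℝ, 0 < C ∧
      ∀ {φ : (AdelicGroupData.gl n K).automorphicQuotient → ℂ},
        IsCuspFormGL n K (isCompact_glFiniteIntegralLevel_holds n K) (invQuot (AdelicGroupData.gl n K) φ) →
      ∀ {φ' : (AdelicGroupData.gl m K).automorphicQuotient → ℂ},
        IsCuspFormGL m K (isCompact_glFiniteIntegralLevel_holds m K) (invQuot (AdelicGroupData.gl m K) φ') →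
      (∀ B : ℝ, 0 < B → ∃ C : ℝ, 0 ≤ C ∧ ∀ h : GL (Fin m) (AdeleRing (𝓞 K) K),
        ‖whittakerDepth m (invQuot (AdelicGroupData.gl n K) φ) (glCorner (AdeleRing (𝓞 K) K) hmn.le h)‖ *
            ‖invQuot (AdelicGroupData.gl m K) φ' h‖ ≤
          C * min ((((glAbsDet m K h : ℝ≥0ˣ) : ℝ≥0) : ℝ) ^ B) ((((glAbsDet m K h : ℝ≥0ˣ) : ℝ≥0) : ℝ) ^ (-B))) →
      ∀ (β : (AdelicGroupData.gl m K).Adelic → ℝ≥0∞), IsCoveringWeight ↥(AdelicGroupData.gl m K).arithmeticSubgroup β →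
      ∀ s : ℂ, jpssProjIntegral hmn μ' φ φ' s =
        (C : ℂ) * ∫ g, whittakerDepth m (invQuot (AdelicGroupData.gl n K) φ) (glCorner (AdeleRing (𝓞 K) K) hmn.le g) *
          invQuot (AdelicGroupData.gl m K) φ' g *
          ((((glAbsDet m K g : ℝ≥0ˣ) : ℝ≥0) : ℝ) : ℂ) ^ (s - ((n : ℂ) - (m : ℂ)) / 2) * ((β g).toReal : ℂ) ∂ν := by
    intro ν hν
    haveI : @Measure.IsHaarMeasure (AdelicGroupData.gl m K).Adelic (AdelicGroupData.gl m K).adGroup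
        (AdelicGroupData.gl m K).adTop (adelicBorel m K) ν := hν
    obtain ⟨C, hC, h⟩ := GapProjectedQuotientUnfolding.stub_gap_proj_quotient_unfolding hm hmn μ' ν
    exact ⟨C, hC, fun {φ} hφ {φ'} hφ' hdec β hβ s =>
      (h φ (continuous_whittakerDepth hφ.1.continuous_gl m) φ' hφ'.1.continuous_gl hdec β hβ s).2⟩
  exact entire_of_bricks hm hmn νA νK ν₀ ν₀' μ'
    (GapProjectedGlobal.exists_const_projected_of hm hmn μ' νA νK hQU
      (GapProjectedWhittakerUnfolding.stub_gap_proj_whittaker_unfolding hm hmn))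
    (fun hφc hφ'c h₁ h₂ => (GapProjectedAnalytic.stub_gap_proj_analytic hm hmn μ' hφc hφ'c h₁ h₂).1)
    hD1 hD2 hcusp hcusp' hΦA hΦ'A

end Registered

end Summit.Langlands.Langlands.Theorems.GapEntireFactOfDecay

end
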